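/-
Copyright (c) 2026. All rights reserved.
Released under Apache 2.0 license as described in the file LICENSE.
Authors: HodgeCM publication cell (pub-hodgecm), GR lane, seat GR-2 (`pub-hodgecm-own-hyp34`).
-/
import Literature.NumberTheory.Weil1964.ArchDualPairL2Continuity
import Literature.NumberTheory.Weil1964.AdelicMetaplecticUnitaryLeg
import Literature.NumberTheory.GelbartRogawski1991.Prop311PrintedMpLeg
import HarnessLib

-- buildfix G11b-3 recipe (LEDGER B13-1/B13-3): elaborate sequentially (dependent telescopes of the dual-pair datum).
set_option Elab.async false

/-!
# `L²`-continuity of the Weil representation along a compatible splitting of `U(V) × U(1)` — the line datum of Prop. 3.1.1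

Topic `NumberTheory/GelbartRogawski1991`; namespace `Literature.NumberTheory.GelbartRogawski1991.Prop311`.  KERNEL ONLY:
definitions with bodies (`lineFst`, `lineSignConv`) and proved theorems; nothing of [GelbartRogawski1991] or [Weil1964]
is asserted; `Prop311AsPrinted` is untouched.

The along-the-section sockets of the printed [GelbartRogawski1991, Prop. 3.1.1] (`Prop311PrintedDarbouxLegAlong`,
`printed_conclusion_CM_of_darbouxLeg_along`) consume a compatible splitting `s` of the dual-pair LINE datum
`pairLineDatum` (second factor a hermitian line, big group `U(J_V ⊗ 1)(𝐀)`) together with the continuity of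
`g ↦ φ₁ (relabel (s g))`.  When the leg `φ₁` is the unitary leg on `L²(𝐀_Fⁿ)` (`Weil1964.adelicMpCont.unitaryLegL2`,
`Prop311PrintedLegOfFrame.legOfFrame`), that continuity is the `L²`-continuity of `g ↦ [ω_ψ(s g) Φ]` over the big group;
`Weil1964.ArchDualPairL2Continuity` proves it over the PRODUCT `U(J_V)(𝐀) × U(1)(𝐀)`.  This file closes the gap:

* §1 **`lineFst e he : U(J_V ⊗ 1)(𝐀) →* U(J_V)(𝐀)`** — for a line as second factor the embedding `u ↦ u ⊗ 1` is onto: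
  `lineFst` (= `adelicPairEquiv e` read through `reindex e e (J_V ⊗ₖ 1) = J_V`) is a continuous inverse,
  `adelicInl_lineFst : adelicInl (lineFst g) = g`;
* §2 `lineSignConv`, `nonempty_anyLeviKAKInput_lineSignConv` — the per-place Levi-form `KAK` kind (J1) for `U(V) × U(1)`
  from the RANK-`≤ 1` SIGN PROFILE of `V` at every real place (the line is compact everywhere; no hypothesis on it);
* §3 **`continuous_toL2_omega_pairLineSplitting`** — for `E/F` a CM-type quadratic extension of a totally real field, a
  diagonal frame `t_V i = -2 d fᵢ` of rank `≤ 1` sign profile at every real place, every continuous compatible splitting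
  `s` of `pairLineDatum`, every Haar measure `ν` on `𝐀_Fⁿ` and every class map `i : 𝒮 → L²(ν)`: all orbit maps
  `g ↦ [ω_ψ(s g) Φ]` are continuous on `U(J_V ⊗ 1)(𝐀)`; `continuous_toL2_omega_relabel_pairLineSplitting` — the same
  after the relabelling `adelicMpContRelabel (legGL …)` to the standard Gram matrix (the operator is unchanged).

## References
* [GelbartRogawski1991] S. Gelbart, J. Rogawski, Invent. Math. 105 (1991) 445–472, §3.1 p. 454, Prop. 3.1.1 p. 455 L1–2,
  §3.2 p. 457.
* [Weil1964] A. Weil, Acta Math. 111 (1964) 143–211, Chap. III n° 39 p. 189, n° 41 Lemme 5 p. 192.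
* [KonnoKonno2007] K. Konno, T. Konno, §3.1 (3.1).
-/

set_option autoImplicit false

noncomputable section

open scoped Matrix Real Classical ComplexConjugate Kronecker
open Complex NumberField NumberField.InfinitePlace NumberField.mixedEmbedding IsDedekindDomain MeasureTheory
open Literature.NumberTheory.Automorphic Literature.NumberTheory.Automorphic.UnitaryGroup
open Literature.RepresentationTheory.HeisenbergGroup Literature.Analysis.SegalBargmann
open Literature.RepresentationTheory.KonnoKonno2007 Literature.RepresentationTheory.KonnoKonno2007.RealDualPair
open Literature.NumberTheory.Weil1964

namespace Literature.NumberTheory.GelbartRogawski1991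

namespace Prop311

/-! ## §1. A line as second factor: `u ↦ u ⊗ 1` is an isomorphism `U(J_V)(𝐀) ≅ U(J_V ⊗ 1)(𝐀)` -/

section Line

variable (F : Type) [Field F] [NumberField F] (E : Type) [Field E] [NumberField E] [Algebra F E] (σ : E ≃ₐ[F] E)
  {n : ℕ} (JV : Matrix (Fin n) (Fin n) E) (e : Fin n × Fin 1 ≃ Fin n) (he : ∀ k : Fin n, (e.symm k).1 = k)

/-- **`lineFst : U(J_V ⊗ 1)(𝐀_F) →* U(J_V)(𝐀_F)`**, the inverse of `u ↦ u ⊗ 1` (`adelicPairEquiv e` followed by the identity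
`U(reindex e e (J_V ⊗ₖ 1)) = U(J_V)`). [cite: GelbartRogawski1991, §3.2 p. 457] -/
def lineFst :
    UnitaryGroup.adelicPair F E σ n 1 JV (1 : Matrix (Fin 1) (Fin 1) E) →* UnitaryGroup.adelic F E σ n JV where
  toFun g := ⟨UnitaryGroup.reindexGL e (g : GL (Fin n × Fin 1) (AdeleRing (𝓞 E) E)), by
    have h : UnitaryGroup.reindexGL e (g : GL (Fin n × Fin 1) (AdeleRing (𝓞 E) E)) ∈
        UnitaryGroup.adelic F E σ n (Matrix.reindex e e (JV ⊗ₖ (1 : Matrix (Fin 1) (Fin 1) E))) :=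
      (UnitaryGroup.adelicPairEmb F E σ n 1 e JV (1 : Matrix (Fin 1) (Fin 1) E) g).2
    rwa [reindex_kronecker_one e he JV] at h⟩
  map_one' := Subtype.ext (map_one (UnitaryGroup.reindexGL (S := AdeleRing (𝓞 E) E) e))
  map_mul' g g' := Subtype.ext (map_mul (UnitaryGroup.reindexGL (S := AdeleRing (𝓞 E) E) e) _ _)

omit [NumberField F] in
/-- underlying invertible matrix of `lineFst g`: `reindex e e g`. [cite: GelbartRogawski1991, §3.2 p. 457] -/
theorem coe_lineFst (g : UnitaryGroup.adelicPair F E σ n 1 JV (1 : Matrix (Fin 1) (Fin 1) E)) :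
    ((lineFst F E σ JV e he g : UnitaryGroup.adelic F E σ n JV) : GL (Fin n) (AdeleRing (𝓞 E) E)) =
      UnitaryGroup.reindexGL e (g : GL (Fin n × Fin 1) (AdeleRing (𝓞 E) E)) := rfl

omit [NumberField F] in
include he in
/-- **`(lineFst g) ⊗ 1 = g`**: `u ↦ u ⊗ 1` is onto when the second factor is a line. [cite: GelbartRogawski1991, §3.2
p. 457] -/
theorem adelicInl_lineFst (g : UnitaryGroup.adelicPair F E σ n 1 JV (1 : Matrix (Fin 1) (Fin 1) E)) :
    UnitaryGroup.adelicInl F E σ n 1 JV (1 : Matrix (Fin 1) (Fin 1) E) (lineFst F E σ JV e he g) = g := by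
  refine Subtype.ext (Units.ext (Matrix.ext fun a b => ?_))
  obtain ⟨i, x⟩ := a
  obtain ⟨j, y⟩ := b
  have hx : e.symm i = (i, x) := Prod.ext (he i) (Subsingleton.elim _ _)
  have hy : e.symm j = (j, y) := Prod.ext (he j) (Subsingleton.elim _ _)
  rw [UnitaryGroup.coe_adelicInl, Matrix.kroneckerMap_apply, coe_lineFst, UnitaryGroup.coe_reindexGL,
    Matrix.reindex_apply, Matrix.submatrix_apply, hx, hy, Subsingleton.elim x y, Matrix.one_apply_eq, mul_one]

omit [NumberField F] in
/-- `lineFst` is continuous. [cite: GelbartRogawski1991, §3.2 p. 457] -/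
theorem continuous_lineFst : Continuous (lineFst F E σ JV e he) := by
  have h : Continuous fun g : UnitaryGroup.adelicPair F E σ n 1 JV (1 : Matrix (Fin 1) (Fin 1) E) =>
      UnitaryGroup.reindexGL e (g : GL (Fin n × Fin 1) (AdeleRing (𝓞 E) E)) := by
    exact continuous_subtype_val.comp (UnitaryGroup.continuous_adelicPairEquiv F E σ n 1 e JV (1 : Matrix (Fin 1) (Fin 1) E))
  exact continuous_induced_rng.2 h

end Line

/-! ## §2. The Levi-form `KAK` kind (J1) for `U(V) × U(1)` from the rank-`≤ 1` sign profile of `V` -/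

section Signs

variable {F : Type} [Field F] {n : ℕ} (tV : Fin n → F)

/-- the sign convention of the line case: `+1` at a real place where all but (at most) one of the `σ_v(t_V i)` are
positive, `-1` otherwise. [folklore] -/
def lineSignConv (v : {v : InfinitePlace F // v.IsReal}) : ℝ :=
  if ∃ i₀ : Fin n, ∀ i, i ≠ i₀ → 0 < embedding_of_isReal v.2 (tV i) then 1 else -1

/-- the sign convention vanishes nowhere. [cite: GelbartRogawski1991, §3.1 p. 454] -/
theorem lineSignConv_ne_zero (v : {v : InfinitePlace F // v.IsReal}) : lineSignConv tV v ≠ 0 := by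
  unfold lineSignConv
  split_ifs <;> norm_num

/-- **the per-place `KAK` kind for `U(V) × U(1)`**: if at the real place `v` all but one of the `σ_v(t_V i)` have a common
strict sign (first factor of real rank `≤ 1`), then for ANY non-zero scaling of the line the real pair at `v` is of profile
(J1) (`nonempty_anyLeviKAKInput_of_signs_left`; the line is definite). [cite: KonnoKonno2007, §3.1 (3.1); Folland1989,
§4.2 (4.24) p. 156, Prop. (4.39); Knapp2002, Thm 7.39] -/
theorem nonempty_anyLeviKAKInput_lineSignConv {c' : {v : InfinitePlace F // v.IsReal} → ℝ} (hc' : ∀ v, c' v ≠ 0)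
    (hrank : ∀ v : {v : InfinitePlace F // v.IsReal}, ∃ i₀ : Fin n,
      (∀ i, i ≠ i₀ → 0 < embedding_of_isReal v.2 (tV i)) ∨ ∀ i, i ≠ i₀ → embedding_of_isReal v.2 (tV i) < 0)
    (v : {v : InfinitePlace F // v.IsReal}) :
    Nonempty (AnyLeviKAKInput
      ((fun g : Ginf (PosIdx (placeSignVec tV (lineSignConv tV) v)) (NegIdx (placeSignVec tV (lineSignConv tV) v)) (PosIdx (placeSignVec (fun _ : Fin 1 => (1 : F)) c' v)) (NegIdx (placeSignVec (fun _ : Fin 1 => (1 : F)) c' v)) => (⇑((ι𝕎 (PosIdx (placeSignVec tV (lineSignConv tV) v)) (NegIdx (placeSignVec tV (lineSignConv tV) v)) (PosIdx (placeSignVec (fun _ : Fin 1 => (1 : F)) c' v)) (NegIdx (placeSignVec (fun _ : Fin 1 => (1 : F)) c' v)) g).1 : ((DPIdx (PosIdx (placeSignVec tV (lineSignConv tV) v)) (NegIdx (placeSignVec tV (lineSignConv tV) v)) (PosIdx (placeSignVec (fun _ : Fin 1 => (1 : F)) c' v)) (NegIdx (placeSignVec (fun _ : Fin 1 => (1 :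 F)) c' v)) → ℝ) × (DPIdx (PosIdx (placeSignVec tV (lineSignConv tV) v)) (NegIdx (placeSignVec tV (lineSignConv tV) v)) (PosIdx (placeSignVec (fun _ : Fin 1 => (1 : F)) c' v)) (NegIdx (placeSignVec (fun _ : Fin 1 => (1 : F)) c' v)) → ℝ)) ≃ₗ[ℝ] ((DPIdx (PosIdx (placeSignVec tV (lineSignConv tV) v)) (NegIdx (placeSignVec tV (lineSignConv tV) v)) (PosIdx (placeSignVec (fun _ : Fin 1 => (1 : F)) c' v)) (NegIdx (placeSignVec (fun _ : Fin 1 => (1 : F)) c' v)) → ℝ) × (DPIdx (PosIdx (placeSignVec tV (lineSignConv tV) v)) (NegIdx (placeSignVec tV (lineSignConv tV) v)) (PosIdx (placeSignVec (fun _ : Fin 1 => (1 : F)) c' v)) (NegIdx (placeSignVec (fun _ : Fin 1 => (1 : F)) c' v)) → ℝ))) : PhaseMap (DPIdx (PosIdx (placeSignVec tV (lineSignConv tV) v)) (NegIdx (placeSignVec tV (lineSignConv tV) v)) (PosIdx (placeSignVec (fun _ : Fin 1 => (1 : F)) c' v)) (NegIdx (placeSignVec (fun _ : Fin 1 => (1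 : F)) c' v))))))) := by
  obtain ⟨i₀, hs⟩ : ∃ i₀ : Fin n, ∀ i, i ≠ i₀ → 0 < embedding_of_isReal v.2 (tV i) / lineSignConv tV v := by
    by_cases hpos : ∃ i₀ : Fin n, ∀ i, i ≠ i₀ → 0 < embedding_of_isReal v.2 (tV i)
    · have hc : lineSignConv tV v = 1 := by rw [lineSignConv, if_pos hpos]
      obtain ⟨i₀, h⟩ := hpos
      exact ⟨i₀, fun i hi => by rw [hc, div_one]; exact h i hi⟩
    · have hc : lineSignConv tV v = -1 := by rw [lineSignConv, if_neg hpos]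
      rcases hrank v with ⟨i₀, h | h⟩
      · exact absurd ⟨i₀, h⟩ hpos
      · exact ⟨i₀, fun i hi => by rw [hc, div_neg, div_one, neg_pos]; exact h i hi⟩
  refine nonempty_anyLeviKAKInput_of_signs_left i₀ (fun i hi => hs i hi) ?_
  have h1 : ∀ j : Fin 1, placeSignVec (fun _ : Fin 1 => (1 : F)) c' v j = 1 / c' v := fun j => by
    rw [placeSignVec, map_one]
  rcases lt_or_gt_of_ne (hc' v) with h | h
  · exact Or.inr fun j => by rw [h1]; exact div_neg_of_pos_of_neg one_pos h
  · exact Or.inl fun j => by rw [h1]; exact div_pos one_pos h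

end Signs

/-! ## §3. `L²`-continuity along a compatible splitting of the line datum -/

section Continuity

variable (F : Type) [Field F] [NumberField F] (E : Type) [Field E] [NumberField E] [Algebra F E]
  [Algebra.IsQuadraticExtension F E] [IsTotallyReal F]
  (σ : E ≃ₐ[F] E) (hσ : σ ≠ 1) {δ : E} (hσδ : σ δ = -δ) (hδ : δ ≠ 0) {d : F} (hd : δ * δ = algebraMap F E d)
  (wOf : {v : InfinitePlace F // v.IsReal} → {w : InfinitePlace E // w.IsComplex})
  (hw : ∀ v, σ • (wOf v).1 = (wOf v).1) (hover : ∀ v, (wOf v).1.comap (algebraMap F E) = v.1)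
  {n : ℕ} (f : Fin n → F) (e : Fin n × Fin 1 ≃ Fin n) (he : ∀ k : Fin n, (e.symm k).1 = k)
  (hT : IsUnit (symplecticGram F d f).det)
  [MeasurableSpace (AdeleRing (𝓞 F) F)] [BorelSpace (AdeleRing (𝓞 F) F)]
  (ν : Measure (Fin n → AdeleRing (𝓞 F) F)) [ν.IsAddHaarMeasure]
  (i : piSchwartzBruhat F (Fin n) →ₗ[ℂ] Lp ℂ 2 ν)
  (hi : ∀ Φ : piSchwartzBruhat F (Fin n),
    ((i Φ : Lp ℂ 2 ν) : (Fin n → AdeleRing (𝓞 F) F) → ℂ) =ᵐ[ν] (Φ : (Fin n → AdeleRing (𝓞 F) F) → ℂ))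

include hσ hw hover he hi in
/-- the line case in the diagonal-frame spelling of `Weil1964.continuous_toL2_omega_pairSplitting_canonical`
(`t_V i = -2 d fᵢ`, `t_W = 1`), pulled back along `g ↦ (lineFst g, 1)`. [cite: Weil1964, Chap. III n° 41 Lemme 5 p. 192;
GelbartRogawski1991, §3.1 Prop. 3.1.1 p. 455 L1–2] -/
private theorem continuous_toL2_omega_pairLineSplitting_aux
    (hrank : ∀ v : {v : InfinitePlace F // v.IsReal}, ∃ i₀ : Fin n,
      (∀ i, i ≠ i₀ → 0 < embedding_of_isReal v.2 (-2 * d * f i)) ∨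
        ∀ i, i ≠ i₀ → embedding_of_isReal v.2 (-2 * d * f i) < 0)
    (hWd : IsUnit (Matrix.diagonal fun _ : Fin 1 => (1 : F)).det)
    {s : UnitaryGroup.adelicPair F E σ n 1 ((symplecticGram F d f).map (algebraMap F E)) (1 : Matrix (Fin 1) (Fin 1) E) →*
      adelicMpCont F (Fin n) (UnitaryDualPair.adelicGram F e (Matrix.diagonal fun i => -2 * d * f i)
        (Matrix.diagonal fun _ : Fin 1 => (1 : F)))}
    (hs : (UnitaryDualPair.splittingDatum F E σ n 1 e ((symplecticGram F d f).map (algebraMap F E))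
      (1 : Matrix (Fin 1) (Fin 1) E) hσδ hδ hd (show (Matrix.diagonal fun i => -2 * d * f i).IsSymm from isSymm_symplecticGram F d f)
      (show (Matrix.diagonal fun _ : Fin 1 => (1 : F)).IsSymm from Matrix.isSymm_one)
      (show IsUnit (Matrix.diagonal fun i => -2 * d * f i).det from hT) hWd rfl (one_eq_map_one F E)).IsCompatible s)
    (hsc : Continuous s) (Φ : piSchwartzBruhat F (Fin n)) :
    Continuous fun g : UnitaryGroup.adelicPair F E σ n 1 ((symplecticGram F d f).map (algebraMap F E))
        (1 : Matrix (Fin 1) (Fin 1) E) =>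
      i (adelicMpCont.omega F (Fin n)
        (UnitaryDualPair.adelicGram F e (Matrix.diagonal fun i => -2 * d * f i) (Matrix.diagonal fun _ : Fin 1 => (1 : F)))
        (s g) Φ) := by
  have hδv : ∀ v : {v : InfinitePlace F // v.IsReal}, ((wOf v).1.embedding δ).im ≠ 0 := fun v =>
    UnitaryGroup.im_embedding_delta_ne_zero F E σ (wOf v) (hw v) hσ hσδ hδ
  have hI := nonempty_anyLeviKAKInput_lineSignConv (fun i => -2 * d * f i)
    (c' := fun v => ((wOf v).1.embedding δ).im / lineSignConv (fun i => -2 * d * f i) v)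
    (fun v => div_ne_zero (hδv v) (lineSignConv_ne_zero _ v)) hrank
  have key := continuous_toL2_omega_pairSplitting_canonical E σ n 1 e (fun i => -2 * d * f i) (fun _ => (1 : F))
    rfl (one_eq_map_one F E) hσδ hδ hd (isSymm_symplecticGram F d f) Matrix.isSymm_one ν i hi hσ wOf hw hover
    (lineSignConv fun i => -2 * d * f i) (lineSignConv_ne_zero _) hT hWd hI hs hsc Φ
  -- `s_pair (lineFst g, 1) = s g` (term-mode: no rewriting against the adelic matrix groups)
  have h1 : ∀ g : UnitaryGroup.adelicPair F E σ n 1 ((symplecticGram F d f).map (algebraMap F E))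
      (1 : Matrix (Fin 1) (Fin 1) E),
      UnitaryDualPair.pairSplitting F E σ n 1 e ((symplecticGram F d f).map (algebraMap F E))
          (1 : Matrix (Fin 1) (Fin 1) E) s (lineFst F E σ ((symplecticGram F d f).map (algebraMap F E)) e he g, 1) =
        s g := fun g =>
    (UnitaryDualPair.pairSplitting_apply F E σ n 1 e ((symplecticGram F d f).map (algebraMap F E))
      (1 : Matrix (Fin 1) (Fin 1) E) s _).trans (congrArg s
        (((congrArg (fun y => UnitaryGroup.adelicInl F E σ n 1 ((symplecticGram F d f).map (algebraMap F E))
            (1 : Matrix (Fin 1) (Fin 1) E) (lineFst F E σ ((symplecticGram F d f).map (algebraMap F E)) e he g) * y)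
          (map_one (UnitaryGroup.adelicInr F E σ n 1 ((symplecticGram F d f).map (algebraMap F E))
            (1 : Matrix (Fin 1) (Fin 1) E)))).trans (mul_one _)).trans (adelicInl_lineFst F E σ _ e he g)))
  exact (key.comp ((continuous_lineFst F E σ _ e he).prodMk continuous_const)).congr fun g =>
    congrArg (fun m => i (adelicMpCont.omega F (Fin n)
      (UnitaryDualPair.adelicGram F e (Matrix.diagonal fun i => -2 * d * f i) (Matrix.diagonal fun _ : Fin 1 => (1 : F)))
      m Φ)) (h1 g)

include hσ hw hover he hi in
/-- **`L²`-continuity of `g ↦ [ω_ψ(s g) Φ]` on the big group `U(J_V ⊗ 1)(𝐀)` of the line datum.**  `E/F` a CM-type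
quadratic extension of a totally real field (`wOf v` a `σ`-fixed complex place over each real `v`), the frame
`t_V i = -2 d fᵢ` (`J_V = symplecticGram`) of real rank `≤ 1` at every real place (`hrank`), `s` a continuous compatible
splitting of `pairLineDatum`: for every Haar measure `ν` on `𝐀_Fⁿ`, every class map `i` (`i Φ =ᵐ Φ`) and every
`Φ ∈ 𝒮(𝐀_Fⁿ)` the orbit map is continuous — `Weil1964.continuous_toL2_omega_pairSplitting_canonical` (Lemme 5 ⇒ dominated
convergence) on `U(J_V)(𝐀) × U(1)(𝐀)`, pulled back along `g ↦ (lineFst g, 1)` (`adelicInl_lineFst`); the line datum is the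
diagonal-frame datum definitionally (`symplecticGram = diagonal (-2 d fᵢ)`, `1 = diagonal 1`).
[cite: Weil1964, Chap. III n° 41 Lemme 5 p. 192, n° 39 p. 189; GelbartRogawski1991, §3.1 Prop. 3.1.1 p. 455 L1–2, §3.2 p. 457;
KonnoKonno2007, §3.1 (3.1)] -/
theorem continuous_toL2_omega_pairLineSplitting
    (hrank : ∀ v : {v : InfinitePlace F // v.IsReal}, ∃ i₀ : Fin n,
      (∀ i, i ≠ i₀ → 0 < embedding_of_isReal v.2 (-2 * d * f i)) ∨
        ∀ i, i ≠ i₀ → embedding_of_isReal v.2 (-2 * d * f i) < 0)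
    {s : UnitaryGroup.adelicPair F E σ n 1 ((symplecticGram F d f).map (algebraMap F E)) (1 : Matrix (Fin 1) (Fin 1) E) →*
      adelicMpCont F (Fin n) (UnitaryDualPair.adelicGram F e (symplecticGram F d f) (1 : Matrix (Fin 1) (Fin 1) F))}
    (hs : (pairLineDatum F E σ hσδ hδ hd f e hT).IsCompatible s) (hsc : Continuous s)
    (Φ : piSchwartzBruhat F (Fin n)) :
    Continuous fun g => i (adelicMpCont.omega F (Fin n)
      (UnitaryDualPair.adelicGram F e (symplecticGram F d f) (1 : Matrix (Fin 1) (Fin 1) F)) (s g) Φ) := by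
  -- the three definitional conversions (each cheap on its own; see the module docstring)
  have hWd : IsUnit (Matrix.diagonal fun _ : Fin 1 => (1 : F)).det := by
    rw [Matrix.diagonal_one, Matrix.det_one]; exact isUnit_one
  have hsc' : Continuous (s : UnitaryGroup.adelicPair F E σ n 1 ((symplecticGram F d f).map (algebraMap F E))
      (1 : Matrix (Fin 1) (Fin 1) E) →*
      adelicMpCont F (Fin n) (UnitaryDualPair.adelicGram F e (Matrix.diagonal fun i => -2 * d * f i)
        (Matrix.diagonal fun _ : Fin 1 => (1 : F)))) := hsc
  have hs' : (UnitaryDualPair.splittingDatum F E σ n 1 e ((symplecticGram F d f).map (algebraMap F E))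
      (1 : Matrix (Fin 1) (Fin 1) E) hσδ hδ hd (show (Matrix.diagonal fun i => -2 * d * f i).IsSymm from isSymm_symplecticGram F d f)
      (show (Matrix.diagonal fun _ : Fin 1 => (1 : F)).IsSymm from Matrix.isSymm_one)
      (show IsUnit (Matrix.diagonal fun i => -2 * d * f i).det from hT) hWd rfl (one_eq_map_one F E)).IsCompatible s := hs
  have key := continuous_toL2_omega_pairLineSplitting_aux F E σ hσ hσδ hδ hd wOf hw hover f e he hT ν i hi hrank hWd hs' hsc' Φ
  exact key

omit [Algebra.IsQuadraticExtension F E] [IsTotallyReal F] [MeasurableSpace (AdeleRing (𝓞 F) F)]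
  [BorelSpace (AdeleRing (𝓞 F) F)] in
/-- relabelling to the standard Gram matrix does not move the operator (pointwise `toOp_adelicMpRelabel`).
[cite: GelbartRogawski1991, §3.1 p. 454 L24–25] -/
theorem toOp_adelicMpContRelabel_legGL
    (p : adelicMpCont F (Fin n) (UnitaryDualPair.adelicGram F e (symplecticGram F d f) (1 : Matrix (Fin 1) (Fin 1) F))) :
    adelicMpCont.toOp F (Fin n) (1 : Matrix (Fin n) (Fin n) (AdeleRing (𝓞 F) F))
        (adelicMpContRelabel F (Fin n) (legGL F f e hT) (one_mul_legGL F f e hT) p) =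
      adelicMpCont.toOp F (Fin n) _ p :=
  LinearEquiv.ext fun _ => rfl

include hσ hw hover he hi in
/-- the same after the relabelling `adelicMpContRelabel (legGL …)` of the along-the-section sockets (`Prop311PrintedDarbouxLegAlong`):
the Weil representation is unchanged by relabelling (`toOp_adelicMpRelabel`). [cite: GelbartRogawski1991, §3.1 Prop. 3.1.1
p. 455 L1–2; Weil1964, Chap. III n° 41 Lemme 5 p. 192] -/
theorem continuous_toL2_omega_relabel_pairLineSplitting
    (hrank : ∀ v : {v : InfinitePlace F // v.IsReal}, ∃ i₀ : Fin n,
      (∀ i, i ≠ i₀ → 0 < embedding_of_isReal v.2 (-2 * d * f i)) ∨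
        ∀ i, i ≠ i₀ → embedding_of_isReal v.2 (-2 * d * f i) < 0)
    {s : UnitaryGroup.adelicPair F E σ n 1 ((symplecticGram F d f).map (algebraMap F E)) (1 : Matrix (Fin 1) (Fin 1) E) →*
      adelicMpCont F (Fin n) (UnitaryDualPair.adelicGram F e (symplecticGram F d f) (1 : Matrix (Fin 1) (Fin 1) F))}
    (hs : (pairLineDatum F E σ hσδ hδ hd f e hT).IsCompatible s) (hsc : Continuous s)
    (Φ : piSchwartzBruhat F (Fin n)) :
    Continuous fun g => i (adelicMpCont.toOp F (Fin n) (1 : Matrix (Fin n) (Fin n) (AdeleRing (𝓞 F) F))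
      (adelicMpContRelabel F (Fin n) (legGL F f e hT) (one_mul_legGL F f e hT) (s g)) Φ) := by
  exact (continuous_toL2_omega_pairLineSplitting F E σ hσ hσδ hδ hd wOf hw hover f e he hT ν i hi hrank hs hsc Φ).congr
    fun g => congrArg i ((LinearEquiv.congr_fun (toOp_adelicMpContRelabel_legGL F f e hT (s g)) Φ).trans
      (adelicMpCont.toOp_apply_apply (s g) Φ)).symm

end Continuity

end Prop311

end Literature.NumberTheory.GelbartRogawski1991

end
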